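import Literature.Geometry.Kaehler.ComplexTorusIntegralHodgeLatticeLefschetzPieces
import HarnessLib

/-!
# Ranks and index of the Lefschetz pieces of the integral Hodge lattice: `rk Lˢ Hdgⁱ(X, ℤ)_prim = ρ_pr^{(i)}`,
# `Σ_s rk N_s = rk Hdgᵖ(X, ℤ) = rk ⨆_s N_s`, `[Hdgᵖ(X, ℤ) : ⊕_s N_s] ∣ N₀^{rk}`

Layer `Literature/Geometry/Kaehler`, namespace `Literature.Geometry.Kaehler.ComplexTorus`; lane `lit-hodgefound`
(Track 2 foundations library), seat p09, generation 47, row g47-#4. THEOREMS ONLY (0 definitions); no named fact, net debt 0.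
Completes g47-#3 (`ComplexTorusIntegralHodgeLatticeLefschetzPieces`: the pieces `N_s = Lˢ Hdg^{p−s}(X, ℤ)_prim ⊆ Hᵏ(X, ℤ)`, `k = p + p`, are pairwise
orthogonal, independent, contained in `Hdgᵖ(X, ℤ)`, and `N₀ · Hdgᵖ(X, ℤ) ⊆ ⨆_s N_s`) by the RANK bookkeeping of the integral Lefschetz decomposition
of the Hodge lattice of a polarised abelian variety (`g = j + 2`, type `(d₁, …, d_g)`, `L = lefschetzPow η`, `ρ_pr^{(i)} = rk (Hdgⁱ(X, ℤ) ∩ P^{2i})`):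

* §1 **`rk N_s = ρ_pr^{(i)}`** (`IsPolarizationType.finrank_lefschetzPiece_eq`): `Lˢ` restricts to a `ℤ`-linear ISOMORPHISM
  `Hdgⁱ(X, ℤ) ∩ P^m ≅ N_s` (`2s + m = k ≤ g`, `i + i = m`) — it is injective by hard Lefschetz (the tree's `lefschetzPow_injective`, Lange §7.3.2 (1)).
* §2 **`Σ_{s ≤ p} rk N_s = rk Hdgᵖ(X, ℤ)`** (`IsPolarizationType.sum_finrank_lefschetzPieces_eq`): g46-#1's closed-form rank formula
  `rk Hdgᵖ(X, ℤ) = Σ_{i ≤ p} ρ_pr^{(i)}` IS the sum of the ranks of the Lefschetz pieces (`i = p − s`).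
* §3 **`rk ⨆_s N_s = rk Hdgᵖ(X, ℤ)`** (`IsPolarizationType.finrank_iSup_lefschetzPieces_eq`): `⨆_s N_s ⊆ Hdgᵖ(X, ℤ)` and `x ↦ N₀·x` embeds `Hdgᵖ(X, ℤ)` into
  `⨆_s N_s` (g47-#3), so the orthogonal direct sum of the pieces is a FULL-RANK sublattice; with §2,
  **`rk ⨆_s N_s = Σ_s rk N_s`** (`IsPolarizationType.finrank_iSup_lefschetzPieces_eq_sum`) — the sum is direct and exhausts the rank
  (Lange (5.22): "`H^r_ℤ(M) = ⊕_s Lˢ H^{r−2s}_pr(M, ℤ)`", which over `ℤ` holds up to the finite index of g47-#3).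
* §4 **`Hdgᵖ(X, ℤ) / ⊕_s N_s` is finite**, **`0 < [Hdgᵖ(X, ℤ) : ⊕_s N_s]`** (`IsPolarizationType.finite_quotient_comap_iSup_lefschetzPieces`,
  `….index_comap_iSup_lefschetzPieces_pos`): pulled back along `Hdgᵖ(X, ℤ) ↪ Hᵏ(X, ℤ)` the sum of the pieces is a full-rank sublattice of the
  free abelian group `Hdgᵖ(X, ℤ)` (the tree's `moduleFree_integralHodgeClassesIn`), hence of finite index (Smith normal form).
* §5 **`[Hdgᵖ(X, ℤ) : ⊕_s N_s] ∣ N₀^{rk Hdgᵖ(X, ℤ)}`** (`IsPolarizationType.exists_index_comap_iSup_lefschetzPieces_dvd_pow`) for g47-#3's uniform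
  exponent `N₀` (`N₀ · Hdgᵖ(X, ℤ) ⊆ ⊕_s N_s`), via `[Λ : N₀Λ] = N₀^{rk Λ}` (Lange Prop. 1.1.14's count `Λ/nΛ ≅ (ℤ/n)^{rk}`).
* §6 (row g47-#9, same-seat append) **the index is itself a uniform denominator**, `I_p · Hdgᵖ(X, ℤ) ⊆ ⊕_s N_s`
  (`index_comap_inclusion_nsmul_mem`), and **`I_p = 1` iff `Hdgᵖ(X, ℤ) = ⊕_s N_s` exactly over `ℤ`** (`index_comap_inclusion_eq_one_iff`),
  both for an arbitrary sublattice `S₀ ⊆ Hᵏ(X, ℤ)` in place of `⊕_s N_s`.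
* §7 (row g47-#10, same-seat append) **the denominator of the reduction to primitive classes is `I_p`**: a `θ`-stable family of classes
  containing the primitive integral Hodge classes of codimension `≤ p` contains `I_p · Hdgᵖ(X, ℤ)` (`index_nsmul_mem_of_forall_lefschetzPow_one_mem`;
  g47-#2 had `∃ N`).

## References

* [cite: Lange2023AbelianVarietiesComplex, §5.4.1 Thm. 5.4.2 and (5.22)–(5.23) (PDF p. 275); §7.3.2 (1), (3); §7.2.2; §1.1.2 Prop. 1.1.14]
* [cite: VoisinHodgeI2002, §6.2.3 Lemma 6.26, Rem. 6.27 (PDF p. 126); §7.1.2 (PDF p. 134)]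
* [cite: Huybrechts2016K3, Ch. 14 §0.1]
-/

noncomputable section

-- `Module ℂ` / `SMulZeroClass ℂ` synthesis on `E [⋀^Fin k]→L[ℝ] ℂ` (as in `ComplexTorusLefschetzDecomposition`)
set_option maxSynthPendingDepth 3

open Module Function Complex
open LinearMap (BilinForm)
open Literature.LinearAlgebra.Alternating
open Literature.Analysis.Complex (IsOfTypeAt typeSubmodule)

namespace Literature.Geometry.Kaehler.ComplexTorus

section Rank

variable {ι : Type*} [Fintype ι] [DecidableEq ι] {E : Type*} [NormedAddCommGroup E] [NormedSpace ℂ E]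
  {Φ : (ι → ℝ) ≃L[ℝ] E} {j k p : ℕ} {η : E [⋀^Fin 2]→L[ℝ] ℝ} {d : Fin (j + 2) → ℕ}

/-! ## §1 `rk N_s = ρ_pr^{(i)}`: `Lˢ` is an isomorphism of the primitive Hodge lattice onto the piece -/

omit [DecidableEq ι] in
/-- **`rk (Lˢ Hdgⁱ(X, ℤ)_prim) = ρ_pr^{(i)} = rk (Hdgⁱ(X, ℤ) ∩ P^m)`** (`i + i = m`, `2s + m = k ≤ g`): the bundled Lefschetz power `Lˢ` maps the primitive
integral Hodge lattice `Hdgⁱ(X, ℤ) ∩ P^m` `ℤ`-linearly ONTO the piece `N_s` (by its membership predicate `hN`) and INJECTIVELY (hard Lefschetz: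
`Lˢ : Hᵐ → Hᵏ` is injective for `m + s ≤ g`, the tree's `lefschetzPow_injective`), so the two lattices are isomorphic.
[cite: Lange2023AbelianVarietiesComplex, §7.3.2 (1), (3); §5.4.1 Thm. 5.4.2 and (5.22) (PDF p. 275)] [cite: VoisinHodgeI2002, §6.2.3 Lemma 6.26, Rem. 6.27 (PDF p. 126)] -/
theorem IsPolarizationType.finrank_lefschetzPiece_eq (hd : IsPolarizationType Φ η d) (hη : IsRiemannForm Φ η) {s m i : ℕ}
    (hm : i + i = m) (h : 2 * s + m = k) (hk : k ≤ j + 2) {N : Submodule ℤ ↥(integralForms Φ k)}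
    (hN : ∀ u : ↥(integralForms Φ k), u ∈ N ↔
      ∃ (m' i' : ℕ) (_ : i' + i' = m') (h' : 2 * s + m' = k) (y : E [⋀^Fin m']→L[ℝ] ℂ),
        y ∈ integralHodgeClassesIn Φ m' i' ∧ y ∈ primitiveForms η m' ∧ (u : E [⋀^Fin k]→L[ℝ] ℂ) = lefschetzPow η s h' y) :
    finrank ℤ ↥N = finrank ℤ ↥(integralHodgeClassesIn Φ m i ⊓ (primitiveForms η m).toAddSubgroup) := by
  haveI : FiniteDimensional ℝ E := Module.Finite.equiv Φ.toLinearEquiv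
  haveI : FiniteDimensional ℂ E := Module.Finite.of_restrictScalars_finite ℝ ℂ E
  have hE : finrank ℝ E = Fintype.card ι := by
    rw [← Φ.toLinearEquiv.finrank_eq, Module.finrank_fintype_fun_eq_card]
  have hg : finrank ℂ E = j + 2 := by
    have h := finrank_real_of_complex E
    rw [hE, hd.card_eq] at h
    omega
  have hnd : ∀ v : E, v ≠ 0 → ∃ w : E, η ![v, w] ≠ 0 := fun v hv ↦ by
    by_contra h
    push Not at h
    exact hv (hη.nondegenerate v h)
  -- `Lˢ` as a `ℤ`-linear map `Hdgⁱ(X, ℤ) ∩ P^m → Hᵏ(X, ℤ)`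
  let g : ↥(integralHodgeClassesIn Φ m i ⊓ (primitiveForms η m).toAddSubgroup) →ₗ[ℤ] ↥(integralForms Φ k) :=
    (AddMonoidHom.mk' (fun y : ↥(integralHodgeClassesIn Φ m i ⊓ (primitiveForms η m).toAddSubgroup) ↦
        ⟨lefschetzPow η s h (y : E [⋀^Fin m]→L[ℝ] ℂ),
        lefschetzPow_mem_integralForms hη h ((mem_integralHodgeClassesIn_iff Φ).1 (AddSubgroup.mem_inf.1 y.2).1).1⟩)
      (fun y y' ↦ Subtype.ext (show lefschetzPow η s h ((y : E [⋀^Fin m]→L[ℝ] ℂ) + (y' : E [⋀^Fin m]→L[ℝ] ℂ)) =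
          lefschetzPow η s h (y : E [⋀^Fin m]→L[ℝ] ℂ) + lefschetzPow η s h (y' : E [⋀^Fin m]→L[ℝ] ℂ) from map_add _ _ _))).toIntLinearMap
  have hgapply : ∀ y, ((g y : ↥(integralForms Φ k)) : E [⋀^Fin k]→L[ℝ] ℂ) = lefschetzPow η s h (y : E [⋀^Fin m]→L[ℝ] ℂ) := fun _ ↦ rfl
  -- its range is the piece
  have hrange : LinearMap.range g = N := by
    ext u
    constructor
    · rintro ⟨y, rfl⟩
      exact (hN _).2 ⟨m, i, hm, h, y, (AddSubgroup.mem_inf.1 y.2).1, (AddSubgroup.mem_inf.1 y.2).2, hgapply y⟩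
    · intro hu
      obtain ⟨m', i', hm', h', y', hy'H, hy'P, hy'⟩ := (hN u).1 hu
      obtain rfl : m = m' := by omega
      obtain rfl : i = i' := by omega
      exact ⟨⟨y', AddSubgroup.mem_inf.2 ⟨hy'H, hy'P⟩⟩, Subtype.ext (by rw [hgapply]; exact hy'.symm)⟩
  -- it is injective (hard Lefschetz)
  have hinj : Injective g := fun y y' hyy ↦ by
    apply Subtype.ext
    have h1 := congrArg (fun w : ↥(integralForms Φ k) ↦ (w : E [⋀^Fin k]→L[ℝ] ℂ)) hyy
    simp only [hgapply] at h1
    exact lefschetzPow_injective hnd h (by omega) h1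
  rw [← hrange]
  exact (LinearEquiv.ofInjective g hinj).finrank_eq.symm

/-! ## §2 `Σ_s rk N_s = rk Hdgᵖ(X, ℤ)` -/

omit [DecidableEq ι] in
/-- **`rk N_s = ρ_pr^{(p−s)}`** for the `s`-th piece of the family `N : Fin (p + 1) → (sublattices of Hᵏ(X, ℤ))`, `k = p + p ≤ g`.
[cite: Lange2023AbelianVarietiesComplex, §7.3.2 (1), (3); §5.4.1 (5.22) (PDF p. 275)] -/
theorem IsPolarizationType.finrank_lefschetzPiece_eq_of_family (hd : IsPolarizationType Φ η d) (hη : IsRiemannForm Φ η)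
    (hpk : p + p = k) (hk : k ≤ j + 2) (N : Fin (p + 1) → Submodule ℤ ↥(integralForms Φ k))
    (hN : ∀ (s : Fin (p + 1)) (u : ↥(integralForms Φ k)), u ∈ N s ↔
      ∃ (m i : ℕ) (_ : i + i = m) (h : 2 * (s : ℕ) + m = k) (y : E [⋀^Fin m]→L[ℝ] ℂ),
        y ∈ integralHodgeClassesIn Φ m i ∧ y ∈ primitiveForms η m ∧ (u : E [⋀^Fin k]→L[ℝ] ℂ) = lefschetzPow η (s : ℕ) h y)
    (s : Fin (p + 1)) :
    finrank ℤ ↥(N s) =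
      finrank ℤ ↥(integralHodgeClassesIn Φ (2 * (p - (s : ℕ))) (p - (s : ℕ)) ⊓ (primitiveForms η (2 * (p - (s : ℕ)))).toAddSubgroup) := by
  have hs := s.is_le
  exact hd.finrank_lefschetzPiece_eq hη (m := 2 * (p - (s : ℕ))) (i := p - (s : ℕ)) (by omega) (by omega) hk (hN s)

omit [DecidableEq ι] in
/-- **`Σ_{s ≤ p} rk (Lˢ Hdg^{p−s}(X, ℤ)_prim) = rk Hdgᵖ(X, ℤ)`** (`k = p + p ≤ g`): the ranks of the Lefschetz pieces add up to the rank of the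
integral Hodge lattice — g46-#1's `rk Hdgᵖ(X, ℤ) = Σ_{i ≤ p} ρ_pr^{(i)}` re-indexed by `i = p − s`, each summand being the rank of a piece (§1).
[cite: Lange2023AbelianVarietiesComplex, §7.3.2 (3); §5.4.1 Thm. 5.4.2 and (5.22) (PDF p. 275); §7.2.2] [cite: VoisinHodgeI2002, §6.2.3 Rem. 6.27 (PDF p. 126)] -/
theorem IsPolarizationType.sum_finrank_lefschetzPieces_eq (hd : IsPolarizationType Φ η d) (hη : IsRiemannForm Φ η)
    (hpk : p + p = k) (hk : k ≤ j + 2) (N : Fin (p + 1) → Submodule ℤ ↥(integralForms Φ k))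
    (hN : ∀ (s : Fin (p + 1)) (u : ↥(integralForms Φ k)), u ∈ N s ↔
      ∃ (m i : ℕ) (_ : i + i = m) (h : 2 * (s : ℕ) + m = k) (y : E [⋀^Fin m]→L[ℝ] ℂ),
        y ∈ integralHodgeClassesIn Φ m i ∧ y ∈ primitiveForms η m ∧ (u : E [⋀^Fin k]→L[ℝ] ℂ) = lefschetzPow η (s : ℕ) h y) :
    ∑ s : Fin (p + 1), finrank ℤ ↥(N s) = finrank ℤ ↥(integralHodgeClassesIn Φ k p) := by
  rw [Finset.sum_congr rfl (fun s _ ↦ hd.finrank_lefschetzPiece_eq_of_family hη hpk hk N hN s),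
    hd.finrank_integralHodgeClassesIn_eq_sum hη hpk hk, Finset.sum_range]
  refine Fintype.sum_equiv Fin.revPerm _ _ fun s ↦ ?_
  have hs : p - (s : ℕ) = ((Fin.revPerm s : Fin (p + 1)) : ℕ) := by
    rw [Fin.revPerm_apply, Fin.val_rev]
    omega
  exact congrArg (fun i : ℕ ↦ finrank ℤ ↥(integralHodgeClassesIn Φ (2 * i) i ⊓ (primitiveForms η (2 * i)).toAddSubgroup)) hs

/-! ## §3 `rk ⨆_s N_s = rk Hdgᵖ(X, ℤ) = Σ_s rk N_s`: the orthogonal direct sum of the pieces has full rank -/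

omit [DecidableEq ι] in
/-- **`rk ⨆_s N_s = rk Hdgᵖ(X, ℤ)`**: the sum of the Lefschetz pieces is a sublattice of `Hdgᵖ(X, ℤ)` (`rk ≤`) into which `Hdgᵖ(X, ℤ)` embeds by
`x ↦ N₀·x` (g47-#3's uniform exponent; `rk ≥`) — the integral Lefschetz decomposition has FULL RANK in the Hodge lattice, i.e. finite index.
[cite: Lange2023AbelianVarietiesComplex, §5.4.1 Thm. 5.4.2 and (5.22)–(5.23) (PDF p. 275); §7.3.2 (3)] [cite: Huybrechts2016K3, Ch. 14 §0.1] -/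
theorem IsPolarizationType.finrank_iSup_lefschetzPieces_eq (hd : IsPolarizationType Φ η d) (hη : IsRiemannForm Φ η)
    (hpk : p + p = k) (hk : k ≤ j + 2) (N : Fin (p + 1) → Submodule ℤ ↥(integralForms Φ k))
    (hN : ∀ (s : Fin (p + 1)) (u : ↥(integralForms Φ k)), u ∈ N s ↔
      ∃ (m i : ℕ) (_ : i + i = m) (h : 2 * (s : ℕ) + m = k) (y : E [⋀^Fin m]→L[ℝ] ℂ),
        y ∈ integralHodgeClassesIn Φ m i ∧ y ∈ primitiveForms η m ∧ (u : E [⋀^Fin k]→L[ℝ] ℂ) = lefschetzPow η (s : ℕ) h y) :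
    finrank ℤ ↥(⨆ s, N s) = finrank ℤ ↥(integralHodgeClassesIn Φ k p) := by
  classical
  letI : LinearOrder ι := LinearOrder.lift' (Fintype.equivFin ι) (Fintype.equivFin ι).injective
  haveI : Module.Finite ℤ ↥(integralForms Φ k) := Module.Finite.of_basis (intLatMonomialBasis Φ k)
  -- `⨆ N_s ⊆ Hdgᵖ(X, ℤ)`
  have hle : (⨆ s, N s) ≤ AddSubgroup.toIntSubmodule ((integralHodgeClassesIn Φ k p).addSubgroupOf (integralForms Φ k)) :=
    iSup_le fun s u hu ↦ AddSubgroup.mem_addSubgroupOf.2 (coe_mem_integralHodgeClassesIn_of_mem_lefschetzPiece hη hpk (hN s) hu)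
  have h1 := Submodule.finrank_mono hle
  -- `x ↦ N₀·x` embeds `Hdgᵖ(X, ℤ)` into `⨆ N_s`
  obtain ⟨N₀, hN₀, H⟩ := hd.exists_forall_nsmul_mem_iSup_lefschetzPieces hη hpk hk N hN
  let f : ↥(AddSubgroup.toIntSubmodule ((integralHodgeClassesIn Φ k p).addSubgroupOf (integralForms Φ k))) →ₗ[ℤ] ↥(⨆ s, N s) :=
    LinearMap.codRestrict (⨆ s, N s)
      (N₀ • (AddSubgroup.toIntSubmodule ((integralHodgeClassesIn Φ k p).addSubgroupOf (integralForms Φ k))).subtype)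
      fun x ↦ H (x : ↥(integralForms Φ k)) (AddSubgroup.mem_addSubgroupOf.1 x.2)
  have hfapply : ∀ x, (((f x : ↥(⨆ s, N s)) : ↥(integralForms Φ k)) : E [⋀^Fin k]→L[ℝ] ℂ) =
      (N₀ : ℂ) • ((x : ↥(integralForms Φ k)) : E [⋀^Fin k]→L[ℝ] ℂ) := fun x ↦ by
    rw [Nat.cast_smul_eq_nsmul]
    rfl
  have hf : Injective f := fun x y hxy ↦ by
    have h' := congrArg (fun w : ↥(⨆ s, N s) ↦ ((w : ↥(integralForms Φ k)) : E [⋀^Fin k]→L[ℝ] ℂ)) hxy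
    simp only [hfapply] at h'
    exact Subtype.ext (Subtype.ext (smul_right_injective (E [⋀^Fin k]→L[ℝ] ℂ) (show (N₀ : ℂ) ≠ 0 by exact_mod_cast hN₀.ne') h'))
  have h2 := LinearMap.finrank_le_finrank_of_injective hf
  rw [← finrank_toIntSubmodule_addSubgroupOf_integralHodgeClassesIn Φ k p]
  omega

omit [DecidableEq ι] in
/-- **`rk ⨆_s N_s = Σ_s rk N_s`**: the sum of the Lefschetz pieces is DIRECT at the level of ranks as well (it is `iSupIndep` by g47-#3, and both sides
equal `rk Hdgᵖ(X, ℤ)`): the integral Lefschetz decomposition `⊕_s Lˢ Hdg^{p−s}(X, ℤ)_prim` is a full-rank orthogonal direct sum inside `Hdgᵖ(X, ℤ)`.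
[cite: Lange2023AbelianVarietiesComplex, §5.4.1 (5.22)–(5.23) (PDF p. 275); §7.3.2 (3)] [cite: VoisinHodgeI2002, §6.2.3 Rem. 6.27 (PDF p. 126)] -/
theorem IsPolarizationType.finrank_iSup_lefschetzPieces_eq_sum (hd : IsPolarizationType Φ η d) (hη : IsRiemannForm Φ η)
    (hpk : p + p = k) (hk : k ≤ j + 2) (N : Fin (p + 1) → Submodule ℤ ↥(integralForms Φ k))
    (hN : ∀ (s : Fin (p + 1)) (u : ↥(integralForms Φ k)), u ∈ N s ↔
      ∃ (m i : ℕ) (_ : i + i = m) (h : 2 * (s : ℕ) + m = k) (y : E [⋀^Fin m]→L[ℝ] ℂ),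
        y ∈ integralHodgeClassesIn Φ m i ∧ y ∈ primitiveForms η m ∧ (u : E [⋀^Fin k]→L[ℝ] ℂ) = lefschetzPow η (s : ℕ) h y) :
    finrank ℤ ↥(⨆ s, N s) = ∑ s : Fin (p + 1), finrank ℤ ↥(N s) := by
  rw [hd.finrank_iSup_lefschetzPieces_eq hη hpk hk N hN, hd.sum_finrank_lefschetzPieces_eq hη hpk hk N hN]

/-! ## §4 Finite index: `Hdgᵖ(X, ℤ) / ⊕_s N_s` is a finite group -/

omit [DecidableEq ι] in
/-- **`Hdgᵖ(X, ℤ) / ⊕_s Lˢ Hdg^{p−s}(X, ℤ)_prim` is FINITE** (`k = p + p ≤ g`): pulled back along the inclusion `Hdgᵖ(X, ℤ) ↪ Hᵏ(X, ℤ)`, the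
sum of the Lefschetz pieces is a sublattice of the free abelian group `Hdgᵖ(X, ℤ)` of the SAME rank (§3; the pieces lie in `Hdgᵖ(X, ℤ)` by
g47-#3), so the quotient is finite (Smith normal form, Mathlib's `Submodule.finiteQuotientOfFreeOfRankEq`) — the integral Lefschetz decomposition
holds "up to finite index". [cite: Lange2023AbelianVarietiesComplex, §5.4.1 Thm. 5.4.2 and (5.22)–(5.23) (PDF p. 275); §7.3.2 (3)]
[cite: Huybrechts2016K3, Ch. 14 §0.1] [cite: VoisinHodgeI2002, §6.2.3 Rem. 6.27 (PDF p. 126)] -/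
theorem IsPolarizationType.finite_quotient_comap_iSup_lefschetzPieces (hd : IsPolarizationType Φ η d) (hη : IsRiemannForm Φ η)
    (hpk : p + p = k) (hk : k ≤ j + 2) (N : Fin (p + 1) → Submodule ℤ ↥(integralForms Φ k))
    (hN : ∀ (s : Fin (p + 1)) (u : ↥(integralForms Φ k)), u ∈ N s ↔
      ∃ (m i : ℕ) (_ : i + i = m) (h : 2 * (s : ℕ) + m = k) (y : E [⋀^Fin m]→L[ℝ] ℂ),
        y ∈ integralHodgeClassesIn Φ m i ∧ y ∈ primitiveForms η m ∧ (u : E [⋀^Fin k]→L[ℝ] ℂ) = lefschetzPow η (s : ℕ) h y) :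
    Finite (↥(integralHodgeClassesIn Φ k p) ⧸
      (⨆ s, N s).comap (AddSubgroup.inclusion (integralHodgeClassesIn_le_integralForms Φ k p)).toIntLinearMap) := by
  haveI := moduleFinite_integralHodgeClassesIn Φ k p
  haveI := moduleFree_integralHodgeClassesIn Φ k p
  refine Submodule.finiteQuotientOfFreeOfRankEq _ ?_
  have hinj : Injective (AddSubgroup.inclusion (integralHodgeClassesIn_le_integralForms Φ k p)).toIntLinearMap :=
    AddSubgroup.inclusion_injective (integralHodgeClassesIn_le_integralForms Φ k p)
  have hle : (⨆ s, N s) ≤ LinearMap.range (AddSubgroup.inclusion (integralHodgeClassesIn_le_integralForms Φ k p)).toIntLinearMap :=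
    iSup_le fun s u hu ↦
      ⟨⟨(u : E [⋀^Fin k]→L[ℝ] ℂ), coe_mem_integralHodgeClassesIn_of_mem_lefschetzPiece hη hpk (hN s) hu⟩, Subtype.ext rfl⟩
  rw [(Submodule.equivMapOfInjective _ hinj _).finrank_eq, Submodule.map_comap_eq_self hle,
    hd.finrank_iSup_lefschetzPieces_eq hη hpk hk N hN]

omit [DecidableEq ι] in
/-- **`0 < [Hdgᵖ(X, ℤ) : ⊕_s Lˢ Hdg^{p−s}(X, ℤ)_prim] < ∞`**: the sum of the Lefschetz pieces (pulled back to `Hdgᵖ(X, ℤ)`) has FINITE,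
positive INDEX in the integral Hodge lattice, by §4's finiteness of the quotient.
[cite: Lange2023AbelianVarietiesComplex, §5.4.1 (5.22)–(5.23) (PDF p. 275); §7.3.2 (3)] [cite: Huybrechts2016K3, Ch. 14 §0.1] -/
theorem IsPolarizationType.index_comap_iSup_lefschetzPieces_pos (hd : IsPolarizationType Φ η d) (hη : IsRiemannForm Φ η)
    (hpk : p + p = k) (hk : k ≤ j + 2) (N : Fin (p + 1) → Submodule ℤ ↥(integralForms Φ k))
    (hN : ∀ (s : Fin (p + 1)) (u : ↥(integralForms Φ k)), u ∈ N s ↔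
      ∃ (m i : ℕ) (_ : i + i = m) (h : 2 * (s : ℕ) + m = k) (y : E [⋀^Fin m]→L[ℝ] ℂ),
        y ∈ integralHodgeClassesIn Φ m i ∧ y ∈ primitiveForms η m ∧ (u : E [⋀^Fin k]→L[ℝ] ℂ) = lefschetzPow η (s : ℕ) h y) :
    0 < ((⨆ s, N s).comap
      (AddSubgroup.inclusion (integralHodgeClassesIn_le_integralForms Φ k p)).toIntLinearMap).toAddSubgroup.index := by
  have hfin := hd.finite_quotient_comap_iSup_lefschetzPieces hη hpk hk N hN
  exact Nat.pos_of_ne_zero (AddSubgroup.index_ne_zero_of_finite (hH := hfin))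

/-! ## §5 The index bound `[Hdgᵖ(X, ℤ) : ⊕_s N_s] ∣ N₀^{rk Hdgᵖ(X, ℤ)}` -/

omit [DecidableEq ι] in
/-- **`[Hdgᵖ(X, ℤ) : ⊕_s Lˢ Hdg^{p−s}(X, ℤ)_prim]` divides `N₀^{rk Hdgᵖ(X, ℤ)}`** for the uniform exponent `N₀ > 0` of g47-#3
(`N₀ · Hdgᵖ(X, ℤ) ⊆ ⊕_s N_s`): `N₀ · Hdgᵖ(X, ℤ) ⊆ ⊕_s N_s ⊆ Hdgᵖ(X, ℤ)`, and `[Λ : N₀Λ] = N₀^{rk Λ}` for the free abelian group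
`Λ = Hdgᵖ(X, ℤ)` (`|det(N₀ · 1_Λ)|`, Mathlib's `Submodule.natAbs_det_equiv`), so the index of the middle term divides `N₀^{rk Λ}`.
[cite: Lange2023AbelianVarietiesComplex, §5.4.1 (5.22)–(5.23) (PDF p. 275); §7.3.2 (3); §1.1.2 Prop. 1.1.14 (proof)] [cite: Huybrechts2016K3, Ch. 14 §0.1] -/
theorem IsPolarizationType.exists_index_comap_iSup_lefschetzPieces_dvd_pow (hd : IsPolarizationType Φ η d) (hη : IsRiemannForm Φ η)
    (hpk : p + p = k) (hk : k ≤ j + 2) (N : Fin (p + 1) → Submodule ℤ ↥(integralForms Φ k))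
    (hN : ∀ (s : Fin (p + 1)) (u : ↥(integralForms Φ k)), u ∈ N s ↔
      ∃ (m i : ℕ) (_ : i + i = m) (h : 2 * (s : ℕ) + m = k) (y : E [⋀^Fin m]→L[ℝ] ℂ),
        y ∈ integralHodgeClassesIn Φ m i ∧ y ∈ primitiveForms η m ∧ (u : E [⋀^Fin k]→L[ℝ] ℂ) = lefschetzPow η (s : ℕ) h y) :
    ∃ N₀ : ℕ, 0 < N₀ ∧
      (∀ x : ↥(integralForms Φ k), (x : E [⋀^Fin k]→L[ℝ] ℂ) ∈ integralHodgeClassesIn Φ k p → N₀ • x ∈ ⨆ s, N s) ∧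
      ((⨆ s, N s).comap (AddSubgroup.inclusion (integralHodgeClassesIn_le_integralForms Φ k p)).toIntLinearMap).toAddSubgroup.index ∣
        N₀ ^ finrank ℤ ↥(integralHodgeClassesIn Φ k p) := by
  haveI := moduleFinite_integralHodgeClassesIn Φ k p
  haveI := moduleFree_integralHodgeClassesIn Φ k p
  haveI := isTorsionFree_integralHodgeClassesIn Φ k p
  obtain ⟨N₀, hN₀, H⟩ := hd.exists_forall_nsmul_mem_iSup_lefschetzPieces hη hpk hk N hN
  refine ⟨N₀, hN₀, H, ?_⟩
  have hN₀' : (N₀ : ℤ) ≠ 0 := by exact_mod_cast hN₀.ne'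
  -- multiplication by `N₀` on `Λ = Hdgᵖ(X, ℤ)` and its range `N₀Λ`
  have hinj : Injective ((N₀ : ℤ) • (LinearMap.id : ↥(integralHodgeClassesIn Φ k p) →ₗ[ℤ] ↥(integralHodgeClassesIn Φ k p))) :=
    fun x y hxy ↦ smul_right_injective _ hN₀' hxy
  have hle : LinearMap.range ((N₀ : ℤ) • (LinearMap.id : ↥(integralHodgeClassesIn Φ k p) →ₗ[ℤ] ↥(integralHodgeClassesIn Φ k p))) ≤
      (⨆ s, N s).comap (AddSubgroup.inclusion (integralHodgeClassesIn_le_integralForms Φ k p)).toIntLinearMap := by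
    rintro x ⟨y, rfl⟩
    show (AddSubgroup.inclusion (integralHodgeClassesIn_le_integralForms Φ k p)).toIntLinearMap ((N₀ : ℤ) • y) ∈ ⨆ s, N s
    rw [map_zsmul, natCast_zsmul]
    exact H _ y.2
  -- `[Λ : N₀Λ] = N₀^{rk Λ}`
  have hidx : (LinearMap.range ((N₀ : ℤ) •
      (LinearMap.id : ↥(integralHodgeClassesIn Φ k p) →ₗ[ℤ] ↥(integralHodgeClassesIn Φ k p)))).toAddSubgroup.index =
        N₀ ^ finrank ℤ ↥(integralHodgeClassesIn Φ k p) := by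
    have hdet := Submodule.natAbs_det_equiv (LinearMap.range ((N₀ : ℤ) •
      (LinearMap.id : ↥(integralHodgeClassesIn Φ k p) →ₗ[ℤ] ↥(integralHodgeClassesIn Φ k p)))) (LinearEquiv.ofInjective _ hinj)
    have hcomp : (LinearMap.range ((N₀ : ℤ) •
        (LinearMap.id : ↥(integralHodgeClassesIn Φ k p) →ₗ[ℤ] ↥(integralHodgeClassesIn Φ k p)))).subtype ∘ₗ
          ((LinearEquiv.ofInjective _ hinj : ↥(integralHodgeClassesIn Φ k p) →+ ↥(LinearMap.range ((N₀ : ℤ) •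
            (LinearMap.id : ↥(integralHodgeClassesIn Φ k p) →ₗ[ℤ] ↥(integralHodgeClassesIn Φ k p)))))).toIntLinearMap =
        (N₀ : ℤ) • (LinearMap.id : ↥(integralHodgeClassesIn Φ k p) →ₗ[ℤ] ↥(integralHodgeClassesIn Φ k p)) :=
      LinearMap.ext fun v ↦ rfl
    rw [hcomp, LinearMap.det_smul, LinearMap.det_id, mul_one, Int.natAbs_pow, Int.natAbs_natCast] at hdet
    rw [AddSubgroup.index]
    exact hdet.symm
  rw [← hidx]
  exact AddSubgroup.index_dvd_of_le fun x hx ↦ hle hx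

/-! ## §6 The index is itself a uniform denominator; index `1` iff the sublattice exhausts `Hdgᵖ(X, ℤ)` -/

omit [Fintype ι] [DecidableEq ι] in
/-- **`[Hdgᵖ(X, ℤ) : Λ₁] · Hdgᵖ(X, ℤ) ⊆ Λ₁`** for any sublattice `Λ₁ = S₀ ∩ Hdgᵖ(X, ℤ)` cut out by a sublattice `S₀ ⊆ Hᵏ(X, ℤ)` (index of the
pull-back along `Hdgᵖ(X, ℤ) ↪ Hᵏ(X, ℤ)`; Lagrange in the finite quotient, vacuous when the index is `0`): in particular for `S₀ = ⊕_s N_s` the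
INDEX `I_p` of the integral Lefschetz decomposition is itself a uniform denominator, `I_p · Hdgᵖ(X, ℤ) ⊆ ⊕_s Lˢ Hdg^{p−s}(X, ℤ)_prim`
(g47-#3 gave some `N₀ > 0`, §5 `I_p ∣ N₀^{rk}`, §4 `0 < I_p`). [cite: Lange2023AbelianVarietiesComplex, §5.4.1 (5.22)–(5.23) (PDF p. 275)] [cite: Huybrechts2016K3, Ch. 14 §0.1] -/
theorem index_comap_inclusion_nsmul_mem (S₀ : Submodule ℤ ↥(integralForms Φ k)) (x : ↥(integralForms Φ k))
    (hx : (x : E [⋀^Fin k]→L[ℝ] ℂ) ∈ integralHodgeClassesIn Φ k p) :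
    (S₀.comap (AddSubgroup.inclusion (integralHodgeClassesIn_le_integralForms Φ k p)).toIntLinearMap).toAddSubgroup.index • x ∈ S₀ := by
  have h := AddSubgroup.nsmul_index_mem
    (S₀.comap (AddSubgroup.inclusion (integralHodgeClassesIn_le_integralForms Φ k p)).toIntLinearMap).toAddSubgroup ⟨(x : E [⋀^Fin k]→L[ℝ] ℂ), hx⟩
  have h' : (AddSubgroup.inclusion (integralHodgeClassesIn_le_integralForms Φ k p)).toIntLinearMap
      ((S₀.comap (AddSubgroup.inclusion (integralHodgeClassesIn_le_integralForms Φ k p)).toIntLinearMap).toAddSubgroup.index •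
        (⟨(x : E [⋀^Fin k]→L[ℝ] ℂ), hx⟩ : ↥(integralHodgeClassesIn Φ k p))) ∈ S₀ := h
  have hιx : (AddSubgroup.inclusion (integralHodgeClassesIn_le_integralForms Φ k p)).toIntLinearMap
      (⟨(x : E [⋀^Fin k]→L[ℝ] ℂ), hx⟩ : ↥(integralHodgeClassesIn Φ k p)) = x := Subtype.ext rfl
  rwa [map_nsmul, hιx] at h'

omit [Fintype ι] [DecidableEq ι] in
/-- **Index `1` iff exhaustion**: `[Hdgᵖ(X, ℤ) : S₀ ∩ Hdgᵖ(X, ℤ)] = 1` iff every integral Hodge class lies in `S₀`; for `S₀ = ⊕_s N_s`: the integral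
Lefschetz decomposition of `Hdgᵖ(X, ℤ)` holds EXACTLY over `ℤ` (`Hdgᵖ(X, ℤ) = ⊕_s Lˢ Hdg^{p−s}(X, ℤ)_prim`, Lange's (5.22) with `ℤ`-coefficients)
iff `I_p = 1`. [cite: Lange2023AbelianVarietiesComplex, §5.4.1 Thm. 5.4.2 and (5.22) (PDF p. 275)] [cite: Huybrechts2016K3, Ch. 14 §0.1] -/
theorem index_comap_inclusion_eq_one_iff (S₀ : Submodule ℤ ↥(integralForms Φ k)) :
    (S₀.comap (AddSubgroup.inclusion (integralHodgeClassesIn_le_integralForms Φ k p)).toIntLinearMap).toAddSubgroup.index = 1 ↔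
      ∀ x : ↥(integralForms Φ k), (x : E [⋀^Fin k]→L[ℝ] ℂ) ∈ integralHodgeClassesIn Φ k p → x ∈ S₀ := by
  rw [AddSubgroup.index_eq_one, Submodule.toAddSubgroup_eq_top, Submodule.eq_top_iff']
  constructor
  · intro h x hx
    have hιx : (AddSubgroup.inclusion (integralHodgeClassesIn_le_integralForms Φ k p)).toIntLinearMap
        (⟨(x : E [⋀^Fin k]→L[ℝ] ℂ), hx⟩ : ↥(integralHodgeClassesIn Φ k p)) = x := Subtype.ext rfl
    have h' := h ⟨(x : E [⋀^Fin k]→L[ℝ] ℂ), hx⟩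
    rwa [Submodule.mem_comap, hιx] at h'
  · intro h y
    exact h _ y.2

/-! ## §7 The denominator of the reduction to primitive classes is the index `I_p` -/

omit [Fintype ι] [DecidableEq ι] in
/-- **REDUCTION TO PRIMITIVE CLASSES OVER `ℤ` WITH THE CANONICAL DENOMINATOR `I_p`**: if a `θ`-stable family `A` of classes
(`L¹ A_m ⊆ A_{m+2}`) contains every primitive integral Hodge class of codimension `i ≤ p`, then **`I_p · x ∈ A_k` for every `x ∈ Hdgᵖ(X, ℤ)`**
(`k = p + p`), where `I_p = [Hdgᵖ(X, ℤ) : ⊕_s Lˢ Hdg^{p−s}(X, ℤ)_prim]` is the index of the integral Lefschetz decomposition (§6: `I_p · Hdgᵖ ⊆ ⊕_s N_s`,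
and `⊕_s N_s ⊆ A_k` by `θ`-stability) — g47-#2's reduction `∃ N, N · x ∈ A` with the denominator identified; `I_p > 0` (§4), `I_p ∣ N₀^{rk}` (§5).
[cite: Lange2023AbelianVarietiesComplex, §5.4.1 Thm. 5.4.2 and (5.22)–(5.23) (PDF p. 275); §7.3.2 (3)] [cite: VoisinHodgeI2002, §6.2.3 Rem. 6.27 (PDF p. 126)] -/
theorem index_nsmul_mem_of_forall_lefschetzPow_one_mem (η : E [⋀^Fin 2]→L[ℝ] ℝ) (hpk : p + p = k) (A : (k : ℕ) → AddSubgroup (E [⋀^Fin k]→L[ℝ] ℂ))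
    (hA : ∀ (m k : ℕ) (h : 2 * 1 + m = k) (y : E [⋀^Fin m]→L[ℝ] ℂ), y ∈ A m → lefschetzPow η 1 h y ∈ A k)
    (hprim : ∀ (m i : ℕ), i + i = m → i ≤ p → ∀ y ∈ integralHodgeClassesIn Φ m i, y ∈ primitiveForms η m → y ∈ A m)
    (N : Fin (p + 1) → Submodule ℤ ↥(integralForms Φ k))
    (hN : ∀ (s : Fin (p + 1)) (u : ↥(integralForms Φ k)), u ∈ N s ↔
      ∃ (m i : ℕ) (_ : i + i = m) (h : 2 * (s : ℕ) + m = k) (y : E [⋀^Fin m]→L[ℝ] ℂ),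
        y ∈ integralHodgeClassesIn Φ m i ∧ y ∈ primitiveForms η m ∧ (u : E [⋀^Fin k]→L[ℝ] ℂ) = lefschetzPow η (s : ℕ) h y)
    (x : ↥(integralForms Φ k)) (hx : (x : E [⋀^Fin k]→L[ℝ] ℂ) ∈ integralHodgeClassesIn Φ k p) :
    ((⨆ s, N s).comap (AddSubgroup.inclusion (integralHodgeClassesIn_le_integralForms Φ k p)).toIntLinearMap).toAddSubgroup.index •
      (x : E [⋀^Fin k]→L[ℝ] ℂ) ∈ A k := by
  -- `⊕_s N_s ⊆ A_k` by `θ`-stability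
  have hle : (⨆ s, N s) ≤ AddSubgroup.toIntSubmodule ((A k).addSubgroupOf (integralForms Φ k)) := by
    refine iSup_le fun s u hu ↦ AddSubgroup.mem_addSubgroupOf.2 ?_
    obtain ⟨m, i, hm, h, y, hyH, hyP, huy⟩ := (hN s u).1 hu
    have hs := s.is_le
    rw [huy]
    exact lefschetzPow_mem_of_forall_lefschetzPow_one_mem η A hA s m k h y (hprim m i hm (by omega) y hyH hyP)
  have hmem := hle (index_comap_inclusion_nsmul_mem (p := p) (⨆ s, N s) x hx)
  have hmem' := AddSubgroup.mem_addSubgroupOf.1 hmem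
  rwa [AddSubgroup.coe_nsmul] at hmem'

end Rank

end Literature.Geometry.Kaehler.ComplexTorus

end
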